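import Summits.KontsevichZagierPeriods.KontsevichZagierPeriods.Theses.FurushoPentagon

/-!
# `DualityInKZ`: duality of multiple zeta values is one move of the Kontsevich–Zagier calculus

Item stmt-KontsevichZagierPeriods-3933 (route FurushoPentagon, support `DualityInKZ`):
for every admissible index `s`, the simplex representations `KZ.mzvRep s` and
`KZ.mzvRep (MZV.dual s)` of `ζ(s)` and `ζ(s†)` are KZ-equivalent.

Proof. The affine involution `Φ(t)ᵢ = 1 - t_{w-1-i}` of `ℝ^w` (linear part `-P_rev`, a signed
permutation matrix, `|det| = 1`) maps the open ordered simplex `1 > t₀ > ⋯ > t_{w-1} > 0` onto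
itself and exchanges the forms `ω₀ = dt/t ↔ ω₁ = dt/(1-t)` while reversing the order of the
letters (Zagier 1994, §9; Hoffman 1992, §3; Eie 2013, §1.1); it is `ℚ`-polynomial, injective and
everywhere differentiable, so `[Δ, ∏ ω_{εᵢ}(tᵢ)] − [Δ, ∏ ω_{¬ε_{w-1-i}}(tᵢ)]` is ONE instance of the
change-of-variables move `KZ.changeOfVariablesRel` (`of_sub_of_mem_relations_of_dualWord`).
The representation `mzvRep (dual s)` lives in dimension `weight (dual s)`, equal but not
definitionally equal to `weight s`; the coordinate relabelling along
`finCongr (MZV.weight_dual hs)` is itself a move (`KZ.of_sub_of_reindex_mem_relations`), and the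
relabelled representation is literally the dual-word representation in dimension `weight s`
(`MZV.binaryWord_dual`, `getD_reverse_map_not`).

References: D. Zagier, *Values of zeta functions and their applications*, ECM 1992, Progr. Math.
120 (1994), §9; M. E. Hoffman, *Multiple harmonic series*, Pacific J. Math. 152 (1992), §3,
Thm. 4.4; M. Kontsevich, D. Zagier, *Periods* (2001), §1.2 rule (2).
-/

noncomputable section

open MeasureTheory Set MvPolynomial
open Literature.NumberTheory.Transcendental Literature.NumberTheory.Transcendental.KZ

namespace Summit.KontsevichZagierPeriods.FurushoPentagon.DualityInKZ

/-- **The duality involution is a change-of-variables move.** If `r`, `r'` are two integral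
representations on the open ordered simplex `Δ_w` with integrands `∏ᵢ ω_{εᵢ}(tᵢ)` and
`∏ᵢ ω_{¬ε_{w-1-i}}(tᵢ)` (the dual word), then `[r] − [r'] ∈ KZ.relations`: the substitution
`uᵢ = 1 - t_{w-1-i}` (affine, `|det| = 1`, `Δ_w → Δ_w` bijective, `ω_{¬e}(1 - x) = ω_e(x)`).
[Zagier 1994, §9; Kontsevich–Zagier 2001, §1.2 rule (2)] -/
theorem of_sub_of_mem_relations_of_dualWord {w : ℕ} (r r' : IntegralRep w) (ε : Fin w → Bool)
    (hr : r.domain = openOrderedSimplex w) (hr' : r'.domain = openOrderedSimplex w)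
    (hf : ∀ t ∈ openOrderedSimplex w, r.integrand t = ∏ i, mzvForm (ε i) (t i))
    (hf' : ∀ t ∈ openOrderedSimplex w, r'.integrand t = ∏ i, mzvForm (!ε (Fin.rev i)) (t i)) :
    of r - of r' ∈ relations := by
  -- the linear part `z ↦ -(z ∘ rev)` of the affine involution, as a matrix
  let M : Matrix (Fin w) (Fin w) ℝ :=
    -(1 : Matrix (Fin w) (Fin w) ℝ).submatrix (Fin.revPerm : Fin w ≃ Fin w) (Equiv.refl _)
  let L : (Fin w → ℝ) →L[ℝ] (Fin w → ℝ) := LinearMap.toContinuousLinearMap (Matrix.toLin' M)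
  have hL : ∀ z : Fin w → ℝ, L z = fun j => -z (Fin.rev j) := by
    intro z
    change Matrix.toLin' M z = _
    rw [Matrix.toLin'_apply, Matrix.neg_mulVec, Matrix.submatrix_mulVec_equiv, Matrix.one_mulVec]
    ext j
    simp
  have hdet : |L.det| = 1 := by
    change |LinearMap.det (Matrix.toLin' M)| = 1
    rw [LinearMap.det_toLin', Matrix.det_neg, abs_mul, abs_pow, abs_neg, abs_one, one_pow,
      one_mul, Matrix.abs_det_submatrix_equiv_equiv, Matrix.det_one, abs_one]
  have hΦ : ∀ z : Fin w → ℝ, (fun j => 1 - z (Fin.rev j)) = (fun _ => (1 : ℝ)) + L z := by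
    intro z
    ext j
    simp only [Pi.add_apply, hL]
    ring
  refine changeOfVariablesRel_subset_relations
    ⟨w, r, r', fun z => fun j => 1 - z (Fin.rev j), fun _ => L, ?_, ?_, ?_, ?_, ?_, rfl⟩
  · -- semialgebraic: a polynomial (affine) map with rational coefficients
    convert isSemialgebraicMapOn_aeval r.isSemialgebraic_domain
      (fun j => (1 - X (Fin.rev j) : MvPolynomial (Fin w) ℚ)) using 2 with z
    ext j
    simp
  · -- derivative: the affine map `1 + L` has derivative `L`
    intro z _
    have hΦ' : (fun z : Fin w → ℝ => fun j => 1 - z (Fin.rev j)) =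
        fun z => (fun _ => (1 : ℝ)) + L z :=
      funext hΦ
    rw [hΦ']
    exact (L.hasFDerivWithinAt (s := r.domain) (x := z)).const_add (fun _ => (1 : ℝ))
  · -- injective (an involution)
    intro z₁ _ z₂ _ h
    ext i
    have := congrFun h (Fin.rev i)
    simp only [Fin.rev_rev, sub_right_inj] at this
    exact this
  · -- the image of the simplex is the simplex
    rw [hr', hr]
    ext u
    constructor
    · intro hu
      refine ⟨fun j => 1 - u (Fin.rev j), mem_openOrderedSimplex_dual hu, ?_⟩
      ext j
      simp [Fin.rev_rev]
    · rintro ⟨t, ht, rfl⟩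
      exact mem_openOrderedSimplex_dual ht
  · -- the integrands correspond: `ω_{¬e}(1 - x) = ω_e(x)` and reindexing along `rev`
    intro t ht
    rw [hr] at ht
    rw [hdet, mul_one, hf t ht, hf' _ (mem_openOrderedSimplex_dual ht),
      ← Equiv.prod_comp Fin.revPerm (fun i => mzvForm (ε i) (t i))]
    refine Finset.prod_congr rfl fun i _ => ?_
    simp only [Fin.revPerm_apply, mzvForm_not_one_sub]

/-- Relabelling coordinates along `finCongr h : Fin n ≃ Fin k` carries the open ordered simplex of
`ℝⁿ` to that of `ℝᵏ`. [folklore] -/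
theorem setOf_comp_finCongr_mem_openOrderedSimplex {n k : ℕ} (h : n = k) :
    {t : Fin k → ℝ | (fun j => t (finCongr h j)) ∈ openOrderedSimplex n} =
      openOrderedSimplex k := by
  subst h
  ext t
  simp [finCongr_refl]

/-- **`DualityInKZ`** (item stmt-KontsevichZagierPeriods-3933): for every admissible index `s`,
the simplex representations of `ζ(s)` and of `ζ(s†)` (`MZV.dual s`: binary word read backwards
with `0 ↔ 1`) are equivalent under the moves of the Kontsevich–Zagier calculus — one change of
variables `tᵢ ↦ 1 - t_{w-1-i}` of the open ordered simplex, plus the coordinate relabelling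
`Fin (weight s†) ≃ Fin (weight s)`. [Zagier 1994, §9; Hoffman 1992, Thm. 4.4;
Kontsevich–Zagier 2001, §1.2] -/
theorem DualityInKZ_proof :
    Summit.KontsevichZagierPeriods.KontsevichZagierPeriods.Theses.FurushoPentagon.DualityInKZ := by
  intro s hs
  have hw : MZV.weight (MZV.dual s) = MZV.weight s := MZV.weight_dual hs
  set R : IntegralRep (MZV.weight s) := mzvRep s hs (mzvIntegrand_isSemialgebraicFunOn_holds s)
    (mzvIntegrand_integrableOn_holds s hs) with hR
  set Rd : IntegralRep (MZV.weight (MZV.dual s)) := mzvRep (MZV.dual s) (MZV.isAdmissible_dual hs)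
    (mzvIntegrand_isSemialgebraicFunOn_holds (MZV.dual s))
    (mzvIntegrand_integrableOn_holds (MZV.dual s) (MZV.isAdmissible_dual hs)) with hRd
  have h2 : of Rd - of (Rd.reindex (finCongr hw)) ∈ relations :=
    of_sub_of_reindex_mem_relations Rd (finCongr hw)
  have h1 : of R - of (Rd.reindex (finCongr hw)) ∈ relations := by
    refine of_sub_of_mem_relations_of_dualWord R (Rd.reindex (finCongr hw))
      (fun i => (MZV.binaryWord s).getD i false) (by rw [hR]; rfl) ?_
      (fun t _ => by rw [hR]; rfl) ?_
    · rw [IntegralRep.reindex_domain, hRd, mzvRep_domain]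
      exact setOf_comp_finCongr_mem_openOrderedSimplex hw
    · intro t _
      rw [IntegralRep.reindex_integrand, hRd]
      change mzvIntegrand (MZV.dual s) (fun j => t (finCongr hw j)) = _
      simp only [mzvIntegrand]
      rw [MZV.binaryWord_dual hs, ← Equiv.prod_comp (finCongr hw)
        (fun i => mzvForm (!(MZV.binaryWord s).getD (Fin.rev i) false) (t i))]
      refine Finset.prod_congr rfl fun j _ => ?_
      have hL : (MZV.binaryWord s).length = MZV.weight (MZV.dual s) :=
        hs.length_binaryWord.trans hw.symm
      have hidx : ((Fin.rev j : Fin (MZV.weight (MZV.dual s))) : ℕ) =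
          ((Fin.rev (finCongr hw j) : Fin (MZV.weight s)) : ℕ) := by
        simp only [Fin.val_rev, finCongr_apply_coe]
        omega
      rw [getD_reverse_map_not hL j, hidx]
  have : of R - of Rd =
      (of R - of (Rd.reindex (finCongr hw))) - (of Rd - of (Rd.reindex (finCongr hw))) := by
    abel
  change of R - of Rd ∈ relations
  rw [this]
  exact relations.sub_mem h1 h2

end Summit.KontsevichZagierPeriods.FurushoPentagon.DualityInKZ
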